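import Summits.BirchSwinnertonDyer.BirchSwinnertonDyer.Theses.DerivedKatoValuationDoor
import HarnessLib

/-!
# `Assembly` of route `DerivedKatoValuationDoor` (item stmt-BirchSwinnertonDyer-23032)

The assembly item is the route's ORIGINAL (gen-1) implication chain, curried:
`DerivedKatoDoor → TateTwoCM → PointsTwo → HalfGEThree → AdmissibleZetaClassExists →
StrictRankLeDerivedOrder → StrictCapGivesSelmerCap → GrossZagierKolyvagin → BirchSwinnertonDyer`.
It is honest bookkeeping: four of the eight antecedents (`DerivedKatoDoor`, `TateTwoCM`, `PointsTwo`,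
`HalfGEThree`) are open-problem grade, so nothing unconditional about BSD follows. The proof is the gen-1
glue: analytic rank `≤ 1` by Gross–Zagier–Kolyvagin (named fact, hypothesis), `≥ 3` by the declared
residual, and at analytic rank two the points face is `PointsTwo` while the Tate face `r ≤ 2` is `TateTwoCM`
on CM curves and, on non-CM curves, a door prime `p` (Serre open image + infinitely many good ordinary
primes, both tree theorems) where an admissible Kato zeta class exists (`AdmissibleZetaClassExists`), has
`v_T ≤ 1` (`DerivedKatoDoor`), hence strict rank `≤ 1` (`StrictRankLeDerivedOrder`), hence
`s_p ≤ 2` (`StrictCapGivesSelmerCap`), hence `r ≤ s_p ≤ 2` (Greenberg's identity, tree theorem).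
BSD is not proved by any of this.
[cite: Kato2004Asterisque, Thm. 12.5 and Thm. 17.4] [cite: BurnsKuriharaSano2019, Prop. 4.5]
-/

set_option linter.dupNamespace false

namespace Summit.BirchSwinnertonDyer.BirchSwinnertonDyer.Theorems.DerivedKatoValuationDoor

open Summit.BirchSwinnertonDyer.BirchSwinnertonDyer.Theses.DerivedKatoValuationDoor

/-- **The assembly item of route `DerivedKatoValuationDoor`** (stmt-BirchSwinnertonDyer-23032): the curried
gen-1 implication chain from the eight route statements to the BSD rank statement. Conditional bookkeeping
only — the antecedents `DerivedKatoDoor`, `TateTwoCM`, `PointsTwo`, `HalfGEThree` are open.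
[cite: Kato2004Asterisque, Thm. 12.5 (4)] [cite: BurnsKuriharaSano2019, Prop. 4.5] -/
theorem assembly_proof :
    Summit.BirchSwinnertonDyer.BirchSwinnertonDyer.Theses.DerivedKatoValuationDoor.Assembly := by
  unfold Assembly
  intro hX hCM hPts h3 hAdm hP1 hP2 hGZK W hW
  -- a ≤ 1 : Gross–Zagier–Kolyvagin (named Literature fact, hypothesis)
  rcases Nat.lt_or_ge W.analyticRank 2 with hlt | hge
  · exact ((hGZK W (by omega)).1).symm
  -- a ≥ 3 : the declared residual complement
  rcases Nat.lt_or_ge W.analyticRank 3 with hlt3 | hge3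
  swap
  · exact h3 W hge3
  have ha : W.analyticRank = 2 := by omega
  -- a = 2 : points face = PointsTwo; Tate face = door (non-CM) / TateTwoCM (CM)
  have hlo : 2 ≤ W.mordellWeilRank := hPts W ha
  suffices hhi : W.mordellWeilRank ≤ 2 by omega
  by_cases hcm : W.HasCM
  · exact hCM W hcm ha
  -- non-CM: pass to a global minimal model `C • W`
  obtain ⟨C, hC⟩ := WeierstrassCurve.hasGlobalMinimalModel_rat_holds W
  haveI := hC
  have hj : (C • W).j = W.j := W.variableChange_j C
  have hcm' : ¬ (C • W).HasCM := fun h =>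
    hcm ((WeierstrassCurve.hasCM_iff_of_j_eq hj).mp h)
  have haC : (C • W).analyticRank = 2 := by
    rw [WeierstrassCurve.analyticRank_smul]; exact ha
  have hrC : (C • W).mordellWeilRank = W.mordellWeilRank :=
    WeierstrassCurve.mordellWeilRank_variableChange_holds W C
  -- a door prime: Serre's open image theorem + infinitely many good ordinary primes (tree theorems)
  obtain ⟨p₀, hp₀⟩ := Literature.NumberTheory.EllipticCurves.serre_open_image_holds (C • W) hcm'
  obtain ⟨p, ⟨hp, hgood, hord⟩, hlt⟩ :=
    (WeierstrassCurve.infinite_goodOrdinaryPrimes_holds (C • W)).exists_gt (max p₀ 4)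
  haveI : Fact p.Prime := hp
  have h5 : 5 ≤ p := by have := le_max_right p₀ 4; omega
  have hle : p₀ ≤ p := by have := le_max_left p₀ 4; omega
  have hsurj : (C • W).HasSurjectiveModNGaloisRep p := hp₀ p hp.out hle
  have hdoor : 5 ≤ p ∧ Literature.NumberTheory.EllipticCurves.IsOrdinaryAt (C • W) p ∧
      (C • W).HasSurjectiveModNGaloisRep p :=
    ⟨h5, (Literature.NumberTheory.EllipticCurves.isOrdinaryAt_iff (C • W) p).2 ⟨hgood, hord⟩, hsurj⟩
  haveI : ContinuousSMul ℤ_[p] ((C • W).tateModule p) :=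
    Literature.NumberTheory.EllipticCurves.TateModule.continuousSMul_padicInt
  -- an admissible Kato zeta class at the door prime (P-a), of `T`-valuation ≤ 1 by the door (D-K₂)
  obtain ⟨K, hK, γ, I, z₀, hγ, hadm⟩ := hAdm (C • W) p hdoor
  have hv : ¬ ∃ (h : I.H) (m : ℕ),
      ((p : Literature.NumberTheory.EllipticCurves.IwasawaAlgebra p) ^ m) • z₀ =
        ((PowerSeries.X : Literature.NumberTheory.EllipticCurves.IwasawaAlgebra p) ^ 2) • h :=
    hX (C • W) p haC hdoor K hK γ I z₀ hγ hadm
  -- P1: strict rank ≤ 1; P2: s_p ≤ 2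
  have hstr := hP1 (C • W) p hdoor ⟨K, hK, γ, I, z₀, hγ, hadm, hv⟩
  have hsel : (C • W).selmerCorank p ≤ 2 := hP2 (C • W) p hstr
  -- Kummer: r ≤ s_p (Greenberg's identity s_p = r + corank Ш[p^∞], tree theorem)
  have hid := (C • W).selmerCorank_eq_mordellWeilRank_add_holds p
  omega

end Summit.BirchSwinnertonDyer.BirchSwinnertonDyer.Theorems.DerivedKatoValuationDoor
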